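import Summits.BirchSwinnertonDyer.BirchSwinnertonDyer.Theorems.RamifiedHeegnerPairTwistUnitSaving
import HarnessLib

/-!
# U₁ at the SAVING ROWS of the Gss2 census (rank one), TU|saving — part X: `296820w1`, `304164be1`

Continuation of `…Theorems.RamifiedHeegnerPairTwistUnitSaving` (seat `bsd-trib-w-rhp` g15; doors, framing and data provenance there; generic kernel lemmas g14's `…TwistUnitInert`):
per rank one curve `subGss_three_/Δ_eq_/c₄_eq_/krausList_/surj_three_<label>` IN THE KERNEL, Kraus minimality of `V = E^{(-3)}_min` and of the twist model `Wd`, and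
`u1s_at_<label> : … → MissingUpperBoundAt W 3` by p674548 `LeafShimuraInert.leafRankOneUpper_three_of_shimuraInertDatum_at_saving_of_twistUnit` through
`leafRankOneUpper_three_at_saving_of_sqrtField` — printed facts `hGZK hmod hnf hJL hCO hPrim` as hypotheses; `q₁ ∣ Δ_min`, multiplicative / no-split / Tate certificates, `hFC`, `hshape` off `q₁`, (DEG), field
congruences IN THE KERNEL; `hN hr Dt hc` + the twist `L`-value + `#Ш(Wd)_an` DISPLAYED.  **HONEST FRAMING: theorems only; nothing booked, no item closed; U₁ (26022) / TU|saving / the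
Shimura-curve Heegner-system inputs stay research-level and OPEN class-wide; BSD is NOT proved for any curve by this file.**
[cite: JetchevSkinnerWan2017, §7.4.2 (p. 31)] [cite: PastenShimura2024, Prop. 6.13, Lemma 6.15, Lemma 6.18] [cite: Serre1972, §2.8] [cite: Kraus1989, Prop. 1] [cite: Cremona2006, Table 1]
-/

set_option linter.dupNamespace false
set_option autoImplicit false

noncomputable section

open scoped Classical NumberField

open WeierstrassCurve NumberField IsDedekindDomain IsDedekindDomain.HeightOneSpectrum Rat.HeightOneSpectrum Field Literature Literature.NumberTheory.DiophantineGeometry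
  Literature.NumberTheory.EllipticCurves Literature.NumberTheory.EllipticCurves.ModularForms Literature.NumberTheory.EllipticCurves.Rank1Residual
  Literature.NumberTheory.EllipticCurves.Rank1Residual.Typed Literature.NumberTheory.Automorphic Literature.NumberTheory.EllipticCurves.Rank1Residual.X11RankOneCertificates
  Literature.NumberTheory.EllipticCurves.KrizLi2019 Literature.NumberTheory.GaloisRepresentations Literature.NumberTheory.QuadraticFields Literature.NumberTheory.QuadraticFields.Quadratic
  Summit.BirchSwinnertonDyer.BirchSwinnertonDyer.Rank1Residual Summit.BirchSwinnertonDyer.BirchSwinnertonDyer.Rank1Residual.IntModel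
  Summit.BirchSwinnertonDyer.BirchSwinnertonDyer.Rank2Observatory.Tam Summit.BirchSwinnertonDyer.Rank1Residual Summit.BirchSwinnertonDyer.Rank1Residual.Additive
  Summit.BirchSwinnertonDyer.Rank1Residual.X11b Summit.BirchSwinnertonDyer.Rank1Residual.X11b.Three Summit.BirchSwinnertonDyer.Rank1Residual.X9 Summit.BirchSwinnertonDyer.Rank1Residual.GaloisImage
  Summit.BirchSwinnertonDyer.Rank1Residual.Supersingular Summit.BirchSwinnertonDyer.BirchSwinnertonDyer.Theses.RamifiedHeegnerPair Summit.BirchSwinnertonDyer.BirchSwinnertonDyer.Theorems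
  Summit.BirchSwinnertonDyer.BirchSwinnertonDyer.Theorems.SchneiderFree Summit.BirchSwinnertonDyer.BirchSwinnertonDyer.Theorems.RamifiedPairUpperBound
  Summit.BirchSwinnertonDyer.BirchSwinnertonDyer.Theorems.RamifiedHeegnerPairStepLIntrinsic Summit.BirchSwinnertonDyer.BirchSwinnertonDyer.Theorems.AdditiveBranchIMCGordTwoRankOne.HeegnerKolyvagin
  Summit.BirchSwinnertonDyer.BirchSwinnertonDyer.Theorems.RamifiedHeegnerPairTwistUnitIntrinsic Summit.BirchSwinnertonDyer.BirchSwinnertonDyer.Theorems.RamifiedHeegnerPairTwistUnitAdditive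
  Summit.BirchSwinnertonDyer.BirchSwinnertonDyer.Theorems.RamifiedHeegnerPairTwistUnitInert

namespace Summit.BirchSwinnertonDyer.BirchSwinnertonDyer.Theorems.RamifiedHeegnerPairTwistUnitSaving

open RamifiedHeegnerPairTwistUnitInert

/-! ## §45 `296820w1` = `[0, 0, 0, -22752, 1143396]`, `N = 296820 = 2^2·3^2·5·17·97` (`2`: IV*, `c = 3`, `3`: I₀*, `c = 2`, `5`: I3, `c = 3`, split, `17`: I4, `c = 4`, split, `97`: I1, `c = 1`, non-split); exempted carrier `q₁ = 2` (additive IV*, `c = 3`), inert set `S = {17, 5}` (multiplicative), (DEG) très ramifié at `s₁ = 17` (`3 ∤ ord_{17} Δ = 4`);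
`ρ̄₃` onto (certificate primes `ℓ₁ = 13`, `#Ẽ(𝔽_{13}) = 11`; `ℓ₂ = 19`, `#Ẽ(𝔽_{19}) = 24`); `r_an = 1`, `#E(ℚ)_tors = 1`, `∏ c_ℓ = 72`, `#Ш(E)_an = 1` (Cremona/LMFDB, displayed where used); class `296820w` of size 1.
`V = E^{(-3)}_min = [0, 0, 0, -2528, -42348]` (`#Ṽ(𝔽₃) = 4`).  JSW field `K = ℚ(√-743)` (`743` prime; `17`, `5` inert, every other `ℓ ∣ N` split): the least such `D` with a twist unit (kit j322550: `L(E^{(-743)},1)/Ω = 96 ≠ 0`, root no. `+1`, `Wd = E^{(-743)}_min = [0, 0, 0, -12560218848, -468989489474172]`, `N(Wd) = 163859184180`, `∏c = 24`, `T = 1`, `#Ш(Wd)_an = (L/Ω)T²/∏c = 4` exactly). -/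

/-- `V = [0, 0, 0, -2528, -42348]` (the minimal model of `296820w1^{(-3)}`, conductor `32980`): `Δ ≠ 0` in the kernel. [cite: Cremona2006, Table 1 (Cremona label 296820w1)] -/
theorem isElliptic_sV296820w1 : (⟨0, 0, 0, -2528, -42348⟩ : WeierstrassCurve ℚ).IsElliptic :=
  isElliptic_of_discOf_ne_zero 0 0 0 (-2528) (-42348) (by decide +kernel)

/-- `V` is globally minimal: `|Δ| = 2^8·5^3·17^4·97` kernel-checked, Kraus' criterion prime by prime. [cite: Kraus1989, Prop. 1 and Prop. 2]
[cite: SilvermanAEC2009, VII.1 Remark 1.1] [cite: Cremona2006, Table 1 (Cremona label 296820w1)] -/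
theorem isGloballyMinimal_sV296820w1 : (⟨0, 0, 0, -2528, -42348⟩ : WeierstrassCurve ℚ).IsGloballyMinimal :=
  isGloballyMinimal_of_krausCriterion₃_factored 0 0 0 (-2528) (-42348)
    [(2, 8), (5, 3), (17, 4), (97, 1)] (by decide +kernel)
    (by intro qe hqe; simp only [List.mem_cons, List.not_mem_nil, or_false] at hqe
        rcases hqe with rfl | rfl | rfl | rfl <;> norm_num)
    (by set_option synthInstance.maxSize 2000 in decide +kernel)

/-- `Wd = [0, 0, 0, -12560218848, -468989489474172]` (the minimal model of the twist `296820w1^{(-743)}`, conductor `163859184180`): `Δ ≠ 0` in the kernel. [cite: Cremona2006, Table 1 (Cremona label 296820w1)] -/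
theorem isElliptic_sWd296820w1 : (⟨0, 0, 0, -12560218848, -468989489474172⟩ : WeierstrassCurve ℚ).IsElliptic :=
  isElliptic_of_discOf_ne_zero 0 0 0 (-12560218848) (-468989489474172) (by decide +kernel)

/-- `Wd` is globally minimal: `|Δ| = 2^8·3^6·5^3·17^4·97·743^6` kernel-checked, Kraus' criterion prime by prime. [cite: Kraus1989, Prop. 1 and Prop. 2]
[cite: SilvermanAEC2009, VII.1 Remark 1.1] [cite: Cremona2006, Table 1 (Cremona label 296820w1)] -/
theorem isGloballyMinimal_sWd296820w1 : (⟨0, 0, 0, -12560218848, -468989489474172⟩ : WeierstrassCurve ℚ).IsGloballyMinimal :=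
  isGloballyMinimal_of_krausCriterion₃_factored 0 0 0 (-12560218848) (-468989489474172)
    [(2, 8), (3, 6), (5, 3), (17, 4), (97, 1), (743, 6)] (by decide +kernel)
    (by intro qe hqe; simp only [List.mem_cons, List.not_mem_nil, or_false] at hqe
        rcases hqe with rfl | rfl | rfl | rfl | rfl | rfl <;> norm_num)
    (by set_option synthInstance.maxSize 2000 in decide +kernel)

/-- **`296820w1` is ADDITIVE at `3` and on the cell (G) ∧ ss, IN THE KERNEL**: `3 ∣ Δ`, `3 ∣ c₄`; `C • V^{(-3)} = E` (`[u, r, s, t] = [1, 0, 0, 0]`) with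
`V` globally minimal, `3 ∤ Δ(V)`, `#Ṽ(𝔽₃) = 4` (`a₃(V) = 0`, supersingular), whence `TypeG`, `SubGord`, `SubGss` at `3` (g13's block, unchanged).
[cite: SilvermanAEC2009, VII.5 Prop. 5.1 (a), (c)] [cite: Delbourgo1998, §1.5 (G)] [cite: Cremona2006, Table 1 (Cremona label 296820w1)] -/
theorem subGss_three_296820w1 {W : WeierstrassCurve ℚ} [W.IsElliptic] [W.IsGloballyMinimal] (hWeq : W = (⟨0, 0, 0, -22752, 1143396⟩ : WeierstrassCurve ℚ)) :
    Addv W 3 ∧ SubGss W 3 := by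
  subst hWeq
  haveI := isElliptic_sV296820w1
  haveI := isGloballyMinimal_sV296820w1
  have hIW : integralModelInt (⟨0, 0, 0, -22752, 1143396⟩ : WeierstrassCurve ℚ) = (⟨0, 0, 0, -22752, 1143396⟩ : WeierstrassCurve ℤ) :=
    integralModelInt_eq_of_map_eq _ (map_mk_int 0 0 0 (-22752) 1143396)
  have hadd : Addv (⟨0, 0, 0, -22752, 1143396⟩ : WeierstrassCurve ℚ) 3 := Additive.addv_of_intModel hIW 3 (by decide +kernel) (by decide +kernel)
  have hIV : integralModelInt (⟨0, 0, 0, -2528, -42348⟩ : WeierstrassCurve ℚ) = (⟨0, 0, 0, -2528, -42348⟩ : WeierstrassCurve ℤ) :=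
    integralModelInt_eq_of_map_eq _ (map_mk_int 0 0 0 (-2528) (-42348))
  have hcV : Nat.card ((((⟨0, 0, 0, -2528, -42348⟩ : WeierstrassCurve ℤ)).map (Int.castRingHom (ZMod 3))).toAffine.Point) = 4 := by
    have h := natCard_point_eq_countPoints 0 0 0 (-2528) (-42348) 3 (by norm_num) (by decide +kernel)
    have h' : countPoints [0, 0, 0, -2528, -42348] 3 = 4 := countPoints_eq_of_fast (by decide +kernel)
    exact_mod_cast h.trans h'
  have hgood : GoodSS (⟨0, 0, 0, -2528, -42348⟩ : WeierstrassCurve ℚ) 3 := Supersingular.goodSS_of_intModel 3 hIV (by decide +kernel) hcV (by decide)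
  have hVW : (⟨1, (0 : ℚ), (0 : ℚ), (0 : ℚ)⟩ : VariableChange ℚ) • (⟨0, 0, 0, -2528, -42348⟩ : WeierstrassCurve ℚ).quadraticTwist (-3) =
      (⟨0, 0, 0, -22752, 1143396⟩ : WeierstrassCurve ℚ) := by
    ext <;> simp [WeierstrassCurve.variableChange_a₁, WeierstrassCurve.variableChange_a₂,
      WeierstrassCurve.variableChange_a₃, WeierstrassCurve.variableChange_a₄, WeierstrassCurve.variableChange_a₆,
      WeierstrassCurve.quadraticTwist, WeierstrassCurve.b₂, WeierstrassCurve.b₄, WeierstrassCurve.b₆] <;> norm_num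
  obtain ⟨C, hC⟩ := exists_variableChange_quadraticTwist_symm (⟨0, 0, 0, -22752, 1143396⟩ : WeierstrassCurve ℚ)
    (⟨0, 0, 0, -2528, -42348⟩ : WeierstrassCurve ℚ) (d := (-3 : ℚ)) (by norm_num) ⟨_, hVW⟩
  have hC' : C • (⟨0, 0, 0, -22752, 1143396⟩ : WeierstrassCurve ℚ).quadraticTwist ((-1 : ℚ) ^ ((3 : ℕ) / 2) * (3 : ℕ)) =
      (⟨0, 0, 0, -2528, -42348⟩ : WeierstrassCurve ℚ) := by
    rw [O5.pstar_three]; exact hC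
  have hG : TypeG (⟨0, 0, 0, -22752, 1143396⟩ : WeierstrassCurve ℚ) 3 := (typeG_three_iff_good_twist _ hadd _ C hC').mpr hgood.1
  exact ⟨hadd, (O5.subGss_three_iff_subGord_and_goodSS_twist _ hadd _ C hC).mpr
    ⟨subGord_three_of_typeG_of_addv _ hG hadd, hgood⟩⟩

/-- `Δ(E₀) = 188992655136000 = 2^8·3^6·5^3·17^4·97` on the integer equation of `296820w1`. [cite: Cremona2006, Table 1 (Cremona label 296820w1)] -/
theorem Δ_eq_296820w1 : (⟨0, 0, 0, -22752, 1143396⟩ : WeierstrassCurve ℤ).Δ = 188992655136000 := by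
  norm_num [WeierstrassCurve.Δ, WeierstrassCurve.b₂, WeierstrassCurve.b₄, WeierstrassCurve.b₆, WeierstrassCurve.b₈]

/-- `c₄(E₀) = 1092096` on the integer equation of `296820w1`. [cite: Cremona2006, Table 1 (Cremona label 296820w1)] -/
theorem c₄_eq_296820w1 : (⟨0, 0, 0, -22752, 1143396⟩ : WeierstrassCurve ℤ).c₄ = 1092096 := by
  norm_num [WeierstrassCurve.c₄, WeierstrassCurve.b₂, WeierstrassCurve.b₄]

/-- The Kraus list of `296820w1` consists of primes and multiplies to `|Δ(E₀)|`, IN THE KERNEL: a prime dividing `Δ_min` is one of `[2, 3, 5, 17, 97]`. [cite: Cremona2006, Table 1 (Cremona label 296820w1)] -/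
theorem krausList_296820w1 : (∀ qe ∈ ([(2, 8), (3, 6), (5, 3), (17, 4), (97, 1)] : List (ℕ × ℕ)), qe.1.Prime) ∧
    (([(2, 8), (3, 6), (5, 3), (17, 4), (97, 1)] : List (ℕ × ℕ)).map fun qe => qe.1 ^ qe.2).prod = (188992655136000 : ℤ).natAbs :=
  ⟨by decide +kernel, by decide +kernel⟩

/-- **`ρ̄_{E,3}` ONTO for `296820w1`, IN THE KERNEL** (Frobenius-order witness `hasSurjectiveModNGaloisRep_of_intModel_of_irr_of_order`): at the good prime `ℓ₁ = 13` (`#Ẽ(𝔽_{13}) = 11`,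
`a = 3`) `X² − aX + 13` is irreducible mod `3`; at `ℓ₂ = 19 ≡ 1 (mod 3)` (`#Ẽ = 24`, `a = -4 ≡ 2`, `9 ∤ 24`) an element of order `3`; point counts by `countPoints_eq_of_fast`
(Sage's `is_surjective(3)` agrees). [cite: Serre1972, §2.8 Prop. 19] [cite: Zywina2015, §1] [cite: Cremona2006, Table 1 (Cremona label 296820w1)] -/
theorem surj_three_296820w1 {W : WeierstrassCurve ℚ} [W.IsElliptic] [W.IsGloballyMinimal] (hWeq : W = (⟨0, 0, 0, -22752, 1143396⟩ : WeierstrassCurve ℚ)) : Surj W 3 := by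
  subst hWeq
  haveI : Fact (Nat.Prime 13) := ⟨by norm_num⟩
  haveI : Fact (Nat.Prime 19) := ⟨by norm_num⟩
  have hI : integralModelInt (⟨0, 0, 0, -22752, 1143396⟩ : WeierstrassCurve ℚ) = (⟨0, 0, 0, -22752, 1143396⟩ : WeierstrassCurve ℤ) :=
    integralModelInt_eq_of_map_eq _ (map_mk_int 0 0 0 (-22752) 1143396)
  have hc₁ : Nat.card ((((⟨0, 0, 0, -22752, 1143396⟩ : WeierstrassCurve ℤ)).map (Int.castRingHom (ZMod 13))).toAffine.Point) = 11 := by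
    exact_mod_cast (natCard_point_eq_countPoints 0 0 0 (-22752) 1143396 13 (by norm_num) (by decide +kernel)).trans (countPoints_eq_of_fast (n := 11) (by decide +kernel))
  have hc₂ : Nat.card ((((⟨0, 0, 0, -22752, 1143396⟩ : WeierstrassCurve ℤ)).map (Int.castRingHom (ZMod 19))).toAffine.Point) = 24 := by
    exact_mod_cast (natCard_point_eq_countPoints 0 0 0 (-22752) 1143396 19 (by norm_num) (by decide +kernel)).trans (countPoints_eq_of_fast (n := 24) (by decide +kernel))
  exact hasSurjectiveModNGaloisRep_of_intModel_of_irr_of_order hI 3 13 19 (by norm_num) (by norm_num) (by rw [Δ_eq_296820w1]; norm_num)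
    (by rw [Δ_eq_296820w1]; norm_num) hc₁ hc₂ (by decide) (by decide) (by decide) (by decide)

/-- **U₁ AT `296820w1` ON ITS SAVING ROW (inert-set Shimura-curve road, TU|saving)** — `MissingUpperBoundAt W 3` at `W = E` from rhp-p2 g11's shape p674548
`leafRankOneUpper_three_of_shimuraInertDatum_at_saving_of_twistUnit` through the door `leafRankOneUpper_three_at_saving_of_sqrtField`.  PRINTED: `hGZK hmod hnf hJL hCO hPrim`.  KERNEL: `Addv ∧ SubGss` at `3`; `ρ̄₃` onto;
`q₁ = 2 ∣ Δ_min`; `17`, `5` multiplicative; every prime of `Δ_min` enumerated (`krausList_296820w1`) for `hFC` and for `hshape` off `q₁` (`c = 1` off `Δ_min`, Kodaira–Néron at multiplicative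
primes, Tate certificates at the additive primes `[3]`); (DEG) très ramifié at `s₁ = 17`; the congruences making `17`, `5` inert and the other `ℓ ∣ N` split in
`ℚ(√-743)`; `Cd • E^{(-743)} = Wd`, `Cd = [1, 0, 0, 0]`, `Wd` Kraus-minimal.  DISPLAYED: `hN`, `hr`, `Dt`/`hc` (`3 ∤ c(Dt)`), `hLt` (`L(E^{(-743)},1) ≠ 0`),
`hqd`/`hvd` (`#Ш(Wd)_an = 4`).  NO S2 / Σ / L₀.  Per curve; U₁ (26022) stays OPEN class-wide (`BSDp W 3` then by `bsdp_three_of_upper_of_shaAn_unit`); BSD is NOT proved by this.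
[cite: JetchevSkinnerWan2017, §7.4.2 (p. 31)] [cite: PastenShimura2024, Prop. 6.13, Lemma 6.15, Lemma 6.18] [cite: SilvermanAEC2009, VII.5 Prop. 5.1] [cite: Cremona2006, Table 1 (Cremona label 296820w1)] -/
theorem u1s_at_296820w1
    (hGZK : rank_eq_analyticRank_of_analyticRank_le_one) (hmod : hasEntireLFunction_rat)
    (hnf : exists_isNewformOf) (hJL : nonempty_shimuraParametrizationData)
    (hCO : PastenShimura2024_componentOrders) (hPrim : shimuraCurve_heegnerSystem_primitivesAtThree)
    {W : WeierstrassCurve ℚ} [W.IsElliptic] [W.IsGloballyMinimal] (hWeq : W = (⟨0, 0, 0, -22752, 1143396⟩ : WeierstrassCurve ℚ))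
    (hN : W.conductorNorm ℤ = 296820) [NeZero (W.conductorNorm ℤ)] (hr : W.analyticRank = 1)
    (Dt : ModularParametrizationData W (W.conductorNorm ℤ)) (hc : ¬ (3 : ℤ) ∣ Dt.c)
    (hLt : (W.quadraticTwist (((-743 : ℤ) : ℚ))).entireLFunction 1 ≠ 0)
    {qd : ℚ} (hqd : haveI := isElliptic_sWd296820w1; shaAn (⟨0, 0, 0, -12560218848, -468989489474172⟩ : WeierstrassCurve ℚ) = (qd : ℂ))
    (hvd : padicValRat 3 qd ≤ 0) :
    MissingUpperBoundAt W 3 := by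
  subst hWeq
  haveI := isElliptic_sWd296820w1; haveI := isGloballyMinimal_sWd296820w1
  have hI : integralModelInt (⟨0, 0, 0, -22752, 1143396⟩ : WeierstrassCurve ℚ) = (⟨0, 0, 0, -22752, 1143396⟩ : WeierstrassCurve ℤ) :=
    integralModelInt_eq_of_map_eq _ (map_mk_int 0 0 0 (-22752) 1143396)
  have hGS := subGss_three_296820w1 (W := (⟨0, 0, 0, -22752, 1143396⟩ : WeierstrassCurve ℚ)) rfl
  have hsurj := surj_three_296820w1 (W := (⟨0, 0, 0, -22752, 1143396⟩ : WeierstrassCurve ℚ)) rfl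
  haveI : Fact ((-743 : ℤ) < 0) := ⟨by norm_num⟩; haveI : Fact (Nat.Prime 2) := ⟨by norm_num⟩
  haveI : Fact (Nat.Prime 17) := ⟨by norm_num⟩; haveI : Fact (Nat.Prime 5) := ⟨by norm_num⟩
  have hbad₁ := WeierstrassCurve.not_hasGoodReductionAtPrime_of_dvd_minimalDiscriminantInt (⟨0, 0, 0, -22752, 1143396⟩ : WeierstrassCurve ℚ) 2 (by rw [IntModel.minimalDiscriminantInt_eq hI, Δ_eq_296820w1]; norm_num)
  have hm₁ : (⟨0, 0, 0, -22752, 1143396⟩ : WeierstrassCurve ℚ).HasMultiplicativeReductionAtPrime 17 := IntModel.hasMultiplicativeReductionAtPrime_of_intModel hI 17 (by rw [Δ_eq_296820w1]; norm_num) (by rw [c₄_eq_296820w1]; norm_num)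
  have hm₂ : (⟨0, 0, 0, -22752, 1143396⟩ : WeierstrassCurve ℚ).HasMultiplicativeReductionAtPrime 5 := IntModel.hasMultiplicativeReductionAtPrime_of_intModel hI 5 (by rw [Δ_eq_296820w1]; norm_num) (by rw [c₄_eq_296820w1]; norm_num)
  have hFC : ∀ (ℓ : ℕ) [Fact ℓ.Prime], ℓ ≠ 17 → ℓ ≠ 5 → ℓ ≠ 2 → (⟨0, 0, 0, -22752, 1143396⟩ : WeierstrassCurve ℚ).HasSplitMultiplicativeReductionAtPrime ℓ →
      ¬ 3 ∣ padicValInt ℓ (⟨0, 0, 0, -22752, 1143396⟩ : WeierstrassCurve ℚ).minimalDiscriminantInt := by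
    intro ℓ hℓF hne₁ hne₂ hneq hs
    have hd := dvd_minimalDiscriminantInt_of_mult _ ℓ hs.hasMultiplicativeReductionAtPrime
    rw [IntModel.minimalDiscriminantInt_eq hI, Δ_eq_296820w1] at hd
    have hmem := mem_of_prime_dvd_of_prodPow_eq _ krausList_296820w1 hℓF.out hd
    simp only [List.map_cons, List.map_nil, List.mem_cons, List.not_mem_nil, or_false] at hmem
    rcases hmem with rfl | rfl | rfl | rfl | rfl
    · exact absurd rfl hneq
    · exact absurd hs.hasMultiplicativeReductionAtPrime (X9.PrintCert.not_hasMultiplicativeReductionAtPrime_of_dvd_of_dvd hI 3 (by rw [Δ_eq_296820w1]; norm_num) (by rw [c₄_eq_296820w1]; norm_num))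
    · exact absurd rfl hne₂
    · exact absurd rfl hne₁
    · rw [IntModel.minimalDiscriminantInt_eq hI, Δ_eq_296820w1, IntModel.padicValInt_eq_of_dvd_of_not_dvd 97 (e := 1) (by norm_num) (by norm_num)]
      decide
  have hshape : ∀ (q : ℕ) [Fact q.Prime], q ≠ 2 → 3 ∣ ((⟨0, 0, 0, -22752, 1143396⟩ : WeierstrassCurve ℚ).baseChange ℚ_[q]).localTamagawaNumber ℤ_[q] →
      (⟨0, 0, 0, -22752, 1143396⟩ : WeierstrassCurve ℚ).HasSplitMultiplicativeReductionAtPrime q := by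
    intro q hqF hq h3
    by_cases hd : (q : ℤ) ∣ minimalDiscriminantInt (⟨0, 0, 0, -22752, 1143396⟩ : WeierstrassCurve ℚ)
    swap
    · exact absurd h3 (not_three_dvd_localTamagawaNumber_of_not_dvd _ q hd)
    rw [IntModel.minimalDiscriminantInt_eq hI, Δ_eq_296820w1] at hd
    have hmem := mem_of_prime_dvd_of_prodPow_eq _ krausList_296820w1 hqF.out hd
    simp only [List.map_cons, List.map_nil, List.mem_cons, List.not_mem_nil, or_false] at hmem
    rcases hmem with rfl | rfl | rfl | rfl | rfl
    · exact absurd rfl hq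
    · have hc3 : ((⟨0, 0, 0, -22752, 1143396⟩ : WeierstrassCurve ℚ).baseChange ℚ_[3]).localTamagawaNumber ℤ_[3] = 2 := -- additive `3` (I0*): Tate certificate
        (IntModelTam.localTamagawaNumber_padic_eq_of_intModel_of_tamZ hI 3 (F := ⟨3, 9, 0, 0, 0, 6, 0, 1⟩) rfl (by decide +kernel)).trans (by decide)
      rw [hc3] at h3; exact absurd h3 (by decide)
    · exact (Koly.split_and_three_dvd_of_mult_of_three_dvd_localTamagawaNumber _ 5 (IntModel.hasMultiplicativeReductionAtPrime_of_intModel hI 5 (by rw [Δ_eq_296820w1]; norm_num) (by rw [c₄_eq_296820w1]; norm_num)) h3).1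
    · exact (Koly.split_and_three_dvd_of_mult_of_three_dvd_localTamagawaNumber _ 17 (IntModel.hasMultiplicativeReductionAtPrime_of_intModel hI 17 (by rw [Δ_eq_296820w1]; norm_num) (by rw [c₄_eq_296820w1]; norm_num)) h3).1
    · exact (Koly.split_and_three_dvd_of_mult_of_three_dvd_localTamagawaNumber _ 97 (IntModel.hasMultiplicativeReductionAtPrime_of_intModel hI 97 (by rw [Δ_eq_296820w1]; norm_num) (by rw [c₄_eq_296820w1]; norm_num)) h3).1
  have hjac : ∀ ℓ : ℕ, ℓ.Prime → ℓ ∣ (⟨0, 0, 0, -22752, 1143396⟩ : WeierstrassCurve ℚ).conductorNorm ℤ → ℓ ≠ 17 → ℓ ≠ 5 → ℓ ≠ 2 →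
      jacobiSym (-743) ℓ = 1 := by
    intro ℓ hℓ hℓN hne₁ hne₂ hℓ2
    rw [hN] at hℓN
    have hmem : ℓ ∈ Nat.primeFactors 296820 := Nat.mem_primeFactors.mpr ⟨hℓ, hℓN, by norm_num⟩
    rw [show Nat.primeFactors 296820 = {2, 3, 5, 17, 97} by decide +kernel] at hmem
    simp only [Finset.mem_insert, Finset.mem_singleton] at hmem
    rcases hmem with rfl | rfl | rfl | rfl | rfl
    · exact absurd rfl hℓ2
    · norm_num [jacobiSym.mod_left]
    · exact absurd rfl hne₂
    · exact absurd rfl hne₁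
    · norm_num [jacobiSym.mod_left]
  have hWd : (⟨1, (0 : ℚ), (0 : ℚ), (0 : ℚ)⟩ : VariableChange ℚ) • (⟨0, 0, 0, -22752, 1143396⟩ : WeierstrassCurve ℚ).quadraticTwist (((-743 : ℤ) : ℚ)) =
      (⟨0, 0, 0, -12560218848, -468989489474172⟩ : WeierstrassCurve ℚ) := by
    push_cast; ext <;> simp [WeierstrassCurve.variableChange_a₁, WeierstrassCurve.variableChange_a₂,
      WeierstrassCurve.variableChange_a₃, WeierstrassCurve.variableChange_a₄, WeierstrassCurve.variableChange_a₆,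
      WeierstrassCurve.quadraticTwist, WeierstrassCurve.b₂, WeierstrassCurve.b₄, WeierstrassCurve.b₆] <;> norm_num
  exact leafRankOneUpper_three_at_saving_of_sqrtField hGZK hmod hnf hJL hCO hPrim _ hGS.1 hGS.2 hr hsurj rfl Dt hc 2 hbad₁
    (s₁ := 17) (s₂ := 5) (by decide) (by decide) (by decide) hm₁ hm₂ hFC hshape
    (Or.inl (by rw [IntModel.minimalDiscriminantInt_eq hI, Δ_eq_296820w1, IntModel.padicValInt_eq_of_dvd_of_not_dvd 17 (e := 4) (by norm_num) (by norm_num)]; decide))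
    (-743) (by norm_num) (by rw [show (-743 : ℤ).natAbs = 743 by rfl, Nat.squarefree_iff_nodup_primeFactorsList (by norm_num)]; simp)
    (Or.inr ⟨by decide, by norm_num [jacobiSym.mod_left]⟩) (by norm_num) (Or.inr ⟨by decide, by norm_num [jacobiSym.mod_left]⟩) (by norm_num) hjac
    (fun _ _ _ ↦ by norm_num) hLt _ _ hWd hqd hvd

/-! ## §46 `304164be1` = `[0, 0, 0, -3303, 564030]`, `N = 304164 = 2^2·3^2·7·17·71` (`2`: IV*, `c = 3`, `3`: I₀*, `c = 1`, `7`: I1, `c = 1`, split, `17`: I2, `c = 2`, non-split, `71`: I3, `c = 3`, split); exempted carrier `q₁ = 2` (additive IV*, `c = 3`), inert set `S = {7, 71}` (multiplicative), (DEG) très ramifié at `s₁ = 7` (`3 ∤ ord_{7} Δ = 1`);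
`ρ̄₃` onto (certificate primes `ℓ₁ = 5`, `#Ẽ(𝔽_{5}) = 2`; `ℓ₂ = 61`, `#Ẽ(𝔽_{61}) = 69`); `r_an = 1`, `#E(ℚ)_tors = 1`, `∏ c_ℓ = 18`, `#Ш(E)_an = 1` (Cremona/LMFDB, displayed where used); class `304164be` of size 1.
`V = E^{(-3)}_min = [0, 0, 0, -367, -20890]` (`#Ṽ(𝔽₃) = 1`).  JSW field `K = ℚ(√-191)` (`191` prime; `7`, `71` inert, every other `ℓ ∣ N` split): the least such `D` with a twist unit (kit j322550: `L(E^{(-191)},1)/Ω = 300 ≠ 0`, root no. `+1`, `Wd = E^{(-191)}_min = [0, 0, 0, -120496743, -3930088280130]`, `N(Wd) = 11096206884`, `∏c = 12`, `T = 1`, `#Ш(Wd)_an = (L/Ω)T²/∏c = 25` exactly). -/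

/-- `V = [0, 0, 0, -367, -20890]` (the minimal model of `304164be1^{(-3)}`, conductor `33796`): `Δ ≠ 0` in the kernel. [cite: Cremona2006, Table 1 (Cremona label 304164be1)] -/
theorem isElliptic_sV304164be1 : (⟨0, 0, 0, -367, -20890⟩ : WeierstrassCurve ℚ).IsElliptic :=
  isElliptic_of_discOf_ne_zero 0 0 0 (-367) (-20890) (by decide +kernel)

/-- `V` is globally minimal: `|Δ| = 2^8·7·17^2·71^3` kernel-checked, Kraus' criterion prime by prime. [cite: Kraus1989, Prop. 1 and Prop. 2]
[cite: SilvermanAEC2009, VII.1 Remark 1.1] [cite: Cremona2006, Table 1 (Cremona label 304164be1)] -/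
theorem isGloballyMinimal_sV304164be1 : (⟨0, 0, 0, -367, -20890⟩ : WeierstrassCurve ℚ).IsGloballyMinimal :=
  isGloballyMinimal_of_krausCriterion₃_factored 0 0 0 (-367) (-20890)
    [(2, 8), (7, 1), (17, 2), (71, 3)] (by decide +kernel)
    (by intro qe hqe; simp only [List.mem_cons, List.not_mem_nil, or_false] at hqe
        rcases hqe with rfl | rfl | rfl | rfl <;> norm_num)
    (by set_option synthInstance.maxSize 2000 in decide +kernel)

/-- `Wd = [0, 0, 0, -120496743, -3930088280130]` (the minimal model of the twist `304164be1^{(-191)}`, conductor `11096206884`): `Δ ≠ 0` in the kernel. [cite: Cremona2006, Table 1 (Cremona label 304164be1)] -/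
theorem isElliptic_sWd304164be1 : (⟨0, 0, 0, -120496743, -3930088280130⟩ : WeierstrassCurve ℚ).IsElliptic :=
  isElliptic_of_discOf_ne_zero 0 0 0 (-120496743) (-3930088280130) (by decide +kernel)

/-- `Wd` is globally minimal: `|Δ| = 2^8·3^6·7·17^2·71^3·191^6` kernel-checked, Kraus' criterion prime by prime. [cite: Kraus1989, Prop. 1 and Prop. 2]
[cite: SilvermanAEC2009, VII.1 Remark 1.1] [cite: Cremona2006, Table 1 (Cremona label 304164be1)] -/
theorem isGloballyMinimal_sWd304164be1 : (⟨0, 0, 0, -120496743, -3930088280130⟩ : WeierstrassCurve ℚ).IsGloballyMinimal :=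
  isGloballyMinimal_of_krausCriterion₃_factored 0 0 0 (-120496743) (-3930088280130)
    [(2, 8), (3, 6), (7, 1), (17, 2), (71, 3), (191, 6)] (by decide +kernel)
    (by intro qe hqe; simp only [List.mem_cons, List.not_mem_nil, or_false] at hqe
        rcases hqe with rfl | rfl | rfl | rfl | rfl | rfl <;> norm_num)
    (by set_option synthInstance.maxSize 2000 in decide +kernel)

/-- **`304164be1` is ADDITIVE at `3` and on the cell (G) ∧ ss, IN THE KERNEL**: `3 ∣ Δ`, `3 ∣ c₄`; `C • V^{(-3)} = E` (`[u, r, s, t] = [1, 0, 0, 0]`) with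
`V` globally minimal, `3 ∤ Δ(V)`, `#Ṽ(𝔽₃) = 1` (`a₃(V) = 3`, supersingular), whence `TypeG`, `SubGord`, `SubGss` at `3` (g13's block, unchanged).
[cite: SilvermanAEC2009, VII.5 Prop. 5.1 (a), (c)] [cite: Delbourgo1998, §1.5 (G)] [cite: Cremona2006, Table 1 (Cremona label 304164be1)] -/
theorem subGss_three_304164be1 {W : WeierstrassCurve ℚ} [W.IsElliptic] [W.IsGloballyMinimal] (hWeq : W = (⟨0, 0, 0, -3303, 564030⟩ : WeierstrassCurve ℚ)) :
    Addv W 3 ∧ SubGss W 3 := by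
  subst hWeq
  haveI := isElliptic_sV304164be1
  haveI := isGloballyMinimal_sV304164be1
  have hIW : integralModelInt (⟨0, 0, 0, -3303, 564030⟩ : WeierstrassCurve ℚ) = (⟨0, 0, 0, -3303, 564030⟩ : WeierstrassCurve ℤ) :=
    integralModelInt_eq_of_map_eq _ (map_mk_int 0 0 0 (-3303) 564030)
  have hadd : Addv (⟨0, 0, 0, -3303, 564030⟩ : WeierstrassCurve ℚ) 3 := Additive.addv_of_intModel hIW 3 (by decide +kernel) (by decide +kernel)
  have hIV : integralModelInt (⟨0, 0, 0, -367, -20890⟩ : WeierstrassCurve ℚ) = (⟨0, 0, 0, -367, -20890⟩ : WeierstrassCurve ℤ) :=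
    integralModelInt_eq_of_map_eq _ (map_mk_int 0 0 0 (-367) (-20890))
  have hcV : Nat.card ((((⟨0, 0, 0, -367, -20890⟩ : WeierstrassCurve ℤ)).map (Int.castRingHom (ZMod 3))).toAffine.Point) = 1 := by
    have h := natCard_point_eq_countPoints 0 0 0 (-367) (-20890) 3 (by norm_num) (by decide +kernel)
    have h' : countPoints [0, 0, 0, -367, -20890] 3 = 1 := countPoints_eq_of_fast (by decide +kernel)
    exact_mod_cast h.trans h'
  have hgood : GoodSS (⟨0, 0, 0, -367, -20890⟩ : WeierstrassCurve ℚ) 3 := Supersingular.goodSS_of_intModel 3 hIV (by decide +kernel) hcV (by decide)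
  have hVW : (⟨1, (0 : ℚ), (0 : ℚ), (0 : ℚ)⟩ : VariableChange ℚ) • (⟨0, 0, 0, -367, -20890⟩ : WeierstrassCurve ℚ).quadraticTwist (-3) =
      (⟨0, 0, 0, -3303, 564030⟩ : WeierstrassCurve ℚ) := by
    ext <;> simp [WeierstrassCurve.variableChange_a₁, WeierstrassCurve.variableChange_a₂,
      WeierstrassCurve.variableChange_a₃, WeierstrassCurve.variableChange_a₄, WeierstrassCurve.variableChange_a₆,
      WeierstrassCurve.quadraticTwist, WeierstrassCurve.b₂, WeierstrassCurve.b₄, WeierstrassCurve.b₆] <;> norm_num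
  obtain ⟨C, hC⟩ := exists_variableChange_quadraticTwist_symm (⟨0, 0, 0, -3303, 564030⟩ : WeierstrassCurve ℚ)
    (⟨0, 0, 0, -367, -20890⟩ : WeierstrassCurve ℚ) (d := (-3 : ℚ)) (by norm_num) ⟨_, hVW⟩
  have hC' : C • (⟨0, 0, 0, -3303, 564030⟩ : WeierstrassCurve ℚ).quadraticTwist ((-1 : ℚ) ^ ((3 : ℕ) / 2) * (3 : ℕ)) =
      (⟨0, 0, 0, -367, -20890⟩ : WeierstrassCurve ℚ) := by
    rw [O5.pstar_three]; exact hC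
  have hG : TypeG (⟨0, 0, 0, -3303, 564030⟩ : WeierstrassCurve ℚ) 3 := (typeG_three_iff_good_twist _ hadd _ C hC').mpr hgood.1
  exact ⟨hadd, (O5.subGss_three_iff_subGord_and_goodSS_twist _ hadd _ C hC).mpr
    ⟨subGord_three_of_typeG_of_addv _ hG hadd, hgood⟩⟩

/-- `Δ(E₀) = -135125844924672 = -2^8·3^6·7·17^2·71^3` on the integer equation of `304164be1`. [cite: Cremona2006, Table 1 (Cremona label 304164be1)] -/
theorem Δ_eq_304164be1 : (⟨0, 0, 0, -3303, 564030⟩ : WeierstrassCurve ℤ).Δ = -135125844924672 := by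
  norm_num [WeierstrassCurve.Δ, WeierstrassCurve.b₂, WeierstrassCurve.b₄, WeierstrassCurve.b₆, WeierstrassCurve.b₈]

/-- `c₄(E₀) = 158544` on the integer equation of `304164be1`. [cite: Cremona2006, Table 1 (Cremona label 304164be1)] -/
theorem c₄_eq_304164be1 : (⟨0, 0, 0, -3303, 564030⟩ : WeierstrassCurve ℤ).c₄ = 158544 := by
  norm_num [WeierstrassCurve.c₄, WeierstrassCurve.b₂, WeierstrassCurve.b₄]

/-- The Kraus list of `304164be1` consists of primes and multiplies to `|Δ(E₀)|`, IN THE KERNEL: a prime dividing `Δ_min` is one of `[2, 3, 7, 17, 71]`. [cite: Cremona2006, Table 1 (Cremona label 304164be1)] -/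
theorem krausList_304164be1 : (∀ qe ∈ ([(2, 8), (3, 6), (7, 1), (17, 2), (71, 3)] : List (ℕ × ℕ)), qe.1.Prime) ∧
    (([(2, 8), (3, 6), (7, 1), (17, 2), (71, 3)] : List (ℕ × ℕ)).map fun qe => qe.1 ^ qe.2).prod = (-135125844924672 : ℤ).natAbs :=
  ⟨by decide +kernel, by decide +kernel⟩

/-- **`ρ̄_{E,3}` ONTO for `304164be1`, IN THE KERNEL** (Frobenius-order witness `hasSurjectiveModNGaloisRep_of_intModel_of_irr_of_order`): at the good prime `ℓ₁ = 5` (`#Ẽ(𝔽_{5}) = 2`,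
`a = 4`) `X² − aX + 5` is irreducible mod `3`; at `ℓ₂ = 61 ≡ 1 (mod 3)` (`#Ẽ = 69`, `a = -7 ≡ 2`, `9 ∤ 69`) an element of order `3`; point counts by `countPoints_eq_of_fast`
(Sage's `is_surjective(3)` agrees). [cite: Serre1972, §2.8 Prop. 19] [cite: Zywina2015, §1] [cite: Cremona2006, Table 1 (Cremona label 304164be1)] -/
theorem surj_three_304164be1 {W : WeierstrassCurve ℚ} [W.IsElliptic] [W.IsGloballyMinimal] (hWeq : W = (⟨0, 0, 0, -3303, 564030⟩ : WeierstrassCurve ℚ)) : Surj W 3 := by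
  subst hWeq
  haveI : Fact (Nat.Prime 5) := ⟨by norm_num⟩
  haveI : Fact (Nat.Prime 61) := ⟨by norm_num⟩
  have hI : integralModelInt (⟨0, 0, 0, -3303, 564030⟩ : WeierstrassCurve ℚ) = (⟨0, 0, 0, -3303, 564030⟩ : WeierstrassCurve ℤ) :=
    integralModelInt_eq_of_map_eq _ (map_mk_int 0 0 0 (-3303) 564030)
  have hc₁ : Nat.card ((((⟨0, 0, 0, -3303, 564030⟩ : WeierstrassCurve ℤ)).map (Int.castRingHom (ZMod 5))).toAffine.Point) = 2 := by
    exact_mod_cast (natCard_point_eq_countPoints 0 0 0 (-3303) 564030 5 (by norm_num) (by decide +kernel)).trans (countPoints_eq_of_fast (n := 2) (by decide +kernel))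
  have hc₂ : Nat.card ((((⟨0, 0, 0, -3303, 564030⟩ : WeierstrassCurve ℤ)).map (Int.castRingHom (ZMod 61))).toAffine.Point) = 69 := by
    exact_mod_cast (natCard_point_eq_countPoints 0 0 0 (-3303) 564030 61 (by norm_num) (by decide +kernel)).trans (countPoints_eq_of_fast (n := 69) (by decide +kernel))
  exact hasSurjectiveModNGaloisRep_of_intModel_of_irr_of_order hI 3 5 61 (by norm_num) (by norm_num) (by rw [Δ_eq_304164be1]; norm_num)
    (by rw [Δ_eq_304164be1]; norm_num) hc₁ hc₂ (by decide) (by decide) (by decide) (by decide)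

/-- **U₁ AT `304164be1` ON ITS SAVING ROW (inert-set Shimura-curve road, TU|saving)** — `MissingUpperBoundAt W 3` at `W = E` from rhp-p2 g11's shape p674548
`leafRankOneUpper_three_of_shimuraInertDatum_at_saving_of_twistUnit` through the door `leafRankOneUpper_three_at_saving_of_sqrtField`.  PRINTED: `hGZK hmod hnf hJL hCO hPrim`.  KERNEL: `Addv ∧ SubGss` at `3`; `ρ̄₃` onto;
`q₁ = 2 ∣ Δ_min`; `7`, `71` multiplicative; every prime of `Δ_min` enumerated (`krausList_304164be1`) for `hFC` and for `hshape` off `q₁` (`c = 1` off `Δ_min`, Kodaira–Néron at multiplicative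
primes, Tate certificates at the additive primes `[3]`); (DEG) très ramifié at `s₁ = 7`; the congruences making `7`, `71` inert and the other `ℓ ∣ N` split in
`ℚ(√-191)`; `Cd • E^{(-191)} = Wd`, `Cd = [1, 0, 0, 0]`, `Wd` Kraus-minimal.  DISPLAYED: `hN`, `hr`, `Dt`/`hc` (`3 ∤ c(Dt)`), `hLt` (`L(E^{(-191)},1) ≠ 0`),
`hqd`/`hvd` (`#Ш(Wd)_an = 25`).  NO S2 / Σ / L₀.  Per curve; U₁ (26022) stays OPEN class-wide (`BSDp W 3` then by `bsdp_three_of_upper_of_shaAn_unit`); BSD is NOT proved by this.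
[cite: JetchevSkinnerWan2017, §7.4.2 (p. 31)] [cite: PastenShimura2024, Prop. 6.13, Lemma 6.15, Lemma 6.18] [cite: SilvermanAEC2009, VII.5 Prop. 5.1] [cite: Cremona2006, Table 1 (Cremona label 304164be1)] -/
theorem u1s_at_304164be1
    (hGZK : rank_eq_analyticRank_of_analyticRank_le_one) (hmod : hasEntireLFunction_rat)
    (hnf : exists_isNewformOf) (hJL : nonempty_shimuraParametrizationData)
    (hCO : PastenShimura2024_componentOrders) (hPrim : shimuraCurve_heegnerSystem_primitivesAtThree)
    {W : WeierstrassCurve ℚ} [W.IsElliptic] [W.IsGloballyMinimal] (hWeq : W = (⟨0, 0, 0, -3303, 564030⟩ : WeierstrassCurve ℚ))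
    (hN : W.conductorNorm ℤ = 304164) [NeZero (W.conductorNorm ℤ)] (hr : W.analyticRank = 1)
    (Dt : ModularParametrizationData W (W.conductorNorm ℤ)) (hc : ¬ (3 : ℤ) ∣ Dt.c)
    (hLt : (W.quadraticTwist (((-191 : ℤ) : ℚ))).entireLFunction 1 ≠ 0)
    {qd : ℚ} (hqd : haveI := isElliptic_sWd304164be1; shaAn (⟨0, 0, 0, -120496743, -3930088280130⟩ : WeierstrassCurve ℚ) = (qd : ℂ))
    (hvd : padicValRat 3 qd ≤ 0) :
    MissingUpperBoundAt W 3 := by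
  subst hWeq
  haveI := isElliptic_sWd304164be1; haveI := isGloballyMinimal_sWd304164be1
  have hI : integralModelInt (⟨0, 0, 0, -3303, 564030⟩ : WeierstrassCurve ℚ) = (⟨0, 0, 0, -3303, 564030⟩ : WeierstrassCurve ℤ) :=
    integralModelInt_eq_of_map_eq _ (map_mk_int 0 0 0 (-3303) 564030)
  have hGS := subGss_three_304164be1 (W := (⟨0, 0, 0, -3303, 564030⟩ : WeierstrassCurve ℚ)) rfl
  have hsurj := surj_three_304164be1 (W := (⟨0, 0, 0, -3303, 564030⟩ : WeierstrassCurve ℚ)) rfl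
  haveI : Fact ((-191 : ℤ) < 0) := ⟨by norm_num⟩; haveI : Fact (Nat.Prime 2) := ⟨by norm_num⟩
  haveI : Fact (Nat.Prime 7) := ⟨by norm_num⟩; haveI : Fact (Nat.Prime 71) := ⟨by norm_num⟩
  have hbad₁ := WeierstrassCurve.not_hasGoodReductionAtPrime_of_dvd_minimalDiscriminantInt (⟨0, 0, 0, -3303, 564030⟩ : WeierstrassCurve ℚ) 2 (by rw [IntModel.minimalDiscriminantInt_eq hI, Δ_eq_304164be1]; norm_num)
  have hm₁ : (⟨0, 0, 0, -3303, 564030⟩ : WeierstrassCurve ℚ).HasMultiplicativeReductionAtPrime 7 := IntModel.hasMultiplicativeReductionAtPrime_of_intModel hI 7 (by rw [Δ_eq_304164be1]; norm_num) (by rw [c₄_eq_304164be1]; norm_num)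
  have hm₂ : (⟨0, 0, 0, -3303, 564030⟩ : WeierstrassCurve ℚ).HasMultiplicativeReductionAtPrime 71 := IntModel.hasMultiplicativeReductionAtPrime_of_intModel hI 71 (by rw [Δ_eq_304164be1]; norm_num) (by rw [c₄_eq_304164be1]; norm_num)
  have hFC : ∀ (ℓ : ℕ) [Fact ℓ.Prime], ℓ ≠ 7 → ℓ ≠ 71 → ℓ ≠ 2 → (⟨0, 0, 0, -3303, 564030⟩ : WeierstrassCurve ℚ).HasSplitMultiplicativeReductionAtPrime ℓ →
      ¬ 3 ∣ padicValInt ℓ (⟨0, 0, 0, -3303, 564030⟩ : WeierstrassCurve ℚ).minimalDiscriminantInt := by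
    intro ℓ hℓF hne₁ hne₂ hneq hs
    have hd := dvd_minimalDiscriminantInt_of_mult _ ℓ hs.hasMultiplicativeReductionAtPrime
    rw [IntModel.minimalDiscriminantInt_eq hI, Δ_eq_304164be1] at hd
    have hmem := mem_of_prime_dvd_of_prodPow_eq _ krausList_304164be1 hℓF.out hd
    simp only [List.map_cons, List.map_nil, List.mem_cons, List.not_mem_nil, or_false] at hmem
    rcases hmem with rfl | rfl | rfl | rfl | rfl
    · exact absurd rfl hneq
    · exact absurd hs.hasMultiplicativeReductionAtPrime (X9.PrintCert.not_hasMultiplicativeReductionAtPrime_of_dvd_of_dvd hI 3 (by rw [Δ_eq_304164be1]; norm_num) (by rw [c₄_eq_304164be1]; norm_num))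
    · exact absurd rfl hne₁
    · rw [IntModel.minimalDiscriminantInt_eq hI, Δ_eq_304164be1, IntModel.padicValInt_eq_of_dvd_of_not_dvd 17 (e := 2) (by norm_num) (by norm_num)]
      decide
    · exact absurd rfl hne₂
  have hshape : ∀ (q : ℕ) [Fact q.Prime], q ≠ 2 → 3 ∣ ((⟨0, 0, 0, -3303, 564030⟩ : WeierstrassCurve ℚ).baseChange ℚ_[q]).localTamagawaNumber ℤ_[q] →
      (⟨0, 0, 0, -3303, 564030⟩ : WeierstrassCurve ℚ).HasSplitMultiplicativeReductionAtPrime q := by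
    intro q hqF hq h3
    by_cases hd : (q : ℤ) ∣ minimalDiscriminantInt (⟨0, 0, 0, -3303, 564030⟩ : WeierstrassCurve ℚ)
    swap
    · exact absurd h3 (not_three_dvd_localTamagawaNumber_of_not_dvd _ q hd)
    rw [IntModel.minimalDiscriminantInt_eq hI, Δ_eq_304164be1] at hd
    have hmem := mem_of_prime_dvd_of_prodPow_eq _ krausList_304164be1 hqF.out hd
    simp only [List.map_cons, List.map_nil, List.mem_cons, List.not_mem_nil, or_false] at hmem
    rcases hmem with rfl | rfl | rfl | rfl | rfl
    · exact absurd rfl hq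
    · have hc3 : ((⟨0, 0, 0, -3303, 564030⟩ : WeierstrassCurve ℚ).baseChange ℚ_[3]).localTamagawaNumber ℤ_[3] = 1 := -- additive `3` (I0*): Tate certificate
        (IntModelTam.localTamagawaNumber_padic_eq_of_intModel_of_tamZ hI 3 (F := ⟨3, 9, 0, 0, 0, 6, 0, 0⟩) rfl (by decide +kernel)).trans (by decide)
      rw [hc3] at h3; exact absurd h3 (by decide)
    · exact (Koly.split_and_three_dvd_of_mult_of_three_dvd_localTamagawaNumber _ 7 (IntModel.hasMultiplicativeReductionAtPrime_of_intModel hI 7 (by rw [Δ_eq_304164be1]; norm_num) (by rw [c₄_eq_304164be1]; norm_num)) h3).1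
    · exact (Koly.split_and_three_dvd_of_mult_of_three_dvd_localTamagawaNumber _ 17 (IntModel.hasMultiplicativeReductionAtPrime_of_intModel hI 17 (by rw [Δ_eq_304164be1]; norm_num) (by rw [c₄_eq_304164be1]; norm_num)) h3).1
    · exact (Koly.split_and_three_dvd_of_mult_of_three_dvd_localTamagawaNumber _ 71 (IntModel.hasMultiplicativeReductionAtPrime_of_intModel hI 71 (by rw [Δ_eq_304164be1]; norm_num) (by rw [c₄_eq_304164be1]; norm_num)) h3).1
  have hjac : ∀ ℓ : ℕ, ℓ.Prime → ℓ ∣ (⟨0, 0, 0, -3303, 564030⟩ : WeierstrassCurve ℚ).conductorNorm ℤ → ℓ ≠ 7 → ℓ ≠ 71 → ℓ ≠ 2 →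
      jacobiSym (-191) ℓ = 1 := by
    intro ℓ hℓ hℓN hne₁ hne₂ hℓ2
    rw [hN] at hℓN
    have hmem : ℓ ∈ Nat.primeFactors 304164 := Nat.mem_primeFactors.mpr ⟨hℓ, hℓN, by norm_num⟩
    rw [show Nat.primeFactors 304164 = {2, 3, 7, 17, 71} by decide +kernel] at hmem
    simp only [Finset.mem_insert, Finset.mem_singleton] at hmem
    rcases hmem with rfl | rfl | rfl | rfl | rfl
    · exact absurd rfl hℓ2
    · norm_num [jacobiSym.mod_left]
    · exact absurd rfl hne₁
    · norm_num [jacobiSym.mod_left]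
    · exact absurd rfl hne₂
  have hWd : (⟨1, (0 : ℚ), (0 : ℚ), (0 : ℚ)⟩ : VariableChange ℚ) • (⟨0, 0, 0, -3303, 564030⟩ : WeierstrassCurve ℚ).quadraticTwist (((-191 : ℤ) : ℚ)) =
      (⟨0, 0, 0, -120496743, -3930088280130⟩ : WeierstrassCurve ℚ) := by
    push_cast; ext <;> simp [WeierstrassCurve.variableChange_a₁, WeierstrassCurve.variableChange_a₂,
      WeierstrassCurve.variableChange_a₃, WeierstrassCurve.variableChange_a₄, WeierstrassCurve.variableChange_a₆,
      WeierstrassCurve.quadraticTwist, WeierstrassCurve.b₂, WeierstrassCurve.b₄, WeierstrassCurve.b₆] <;> norm_num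
  exact leafRankOneUpper_three_at_saving_of_sqrtField hGZK hmod hnf hJL hCO hPrim _ hGS.1 hGS.2 hr hsurj rfl Dt hc 2 hbad₁
    (s₁ := 7) (s₂ := 71) (by decide) (by decide) (by decide) hm₁ hm₂ hFC hshape
    (Or.inl (by rw [IntModel.minimalDiscriminantInt_eq hI, Δ_eq_304164be1, IntModel.padicValInt_eq_of_dvd_of_not_dvd 7 (e := 1) (by norm_num) (by norm_num)]; decide))
    (-191) (by norm_num) (by rw [show (-191 : ℤ).natAbs = 191 by rfl, Nat.squarefree_iff_nodup_primeFactorsList (by norm_num)]; simp)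
    (Or.inr ⟨by decide, by norm_num [jacobiSym.mod_left]⟩) (by norm_num) (Or.inr ⟨by decide, by norm_num [jacobiSym.mod_left]⟩) (by norm_num) hjac
    (fun _ _ _ ↦ by norm_num) hLt _ _ hWd hqd hvd

end Summit.BirchSwinnertonDyer.BirchSwinnertonDyer.Theorems.RamifiedHeegnerPairTwistUnitSaving

end
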